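import Mathlib
import HarnessLib
import Literature.MathematicalPhysics.QuantumLattice.HubbardGridCounterQuadraticL1
import Summits.HubbardSuperconductivity.HubbardSuperconductivity.Theorems.KLProgrammeKLRegimeEngineScaleZeroTwoLegGridSumsWeights
import Summits.HubbardSuperconductivity.HubbardSuperconductivity.Theorems.KLProgrammeKLRegimeEngineV8TwoLegGridMomentsFrameBase

/-!
# Route `KLProgramme` — ENGINE child gen 8 (stmt-HubbardSuperconductivity-20437 `KLRegimeEngineV17F2`), class #7 in GRID currency, located risk #9
# («(b)-GRID-FRAME-M1», pen (R59bd)/(R59be), menu (T) ≻ (C2) ≻ (c)): the TIME row of the scale-0 frame-`K` base of the grid atom in PURE `U²`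
# CURRENCY — the counterterm vertex is time-local, so a TIME-ONLY tree weight never reads the frame kernel's first position moment

Cell gate-hubbard-kl, seat hubbard-kl-k3c2-p1 g8 (row «scale-0 Gram step»; (T)-checker (i) of (R59bd)).  k3c2-p3's frame-`K` base
`twoLegGridMomentsAt_scaleZero_of_frameOK(_linear)` (p564283) routes BOTH rows of `TwoLegGridMomentsAt … K 0` through ONE tree weight
`wt₁ = 1 + diam_{space+time}`, so both budgets carry `(Q·|U|)²` with `Q|U| = 4e⁴·F + 16e⁸κ₀²|U|`, `F ≥ Σ_z ‖Ǩ_L(z)‖(1+|z|_∞)` — and the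
registered frame data certify only `F = κ_R|U| + 2(Nsc+1)U²·m_R`, whose second summand is `U`-free at regime depth (memos GRID-FRAME-M1 / -B,
evidence #49/#60 on 20437).  The TIME row does not need that moment:

* §1 the TIME-ONLY label pseudo-distance `d_t((a,x⃗),(b,y⃗)) = (β′/N)·cyclicDist_N(a,b)` and its tree weight `wt_t(S) = 1 + diam_{d_t}(S.image gridLegPos)`
  (`isLabelDist_gridTimeDist`, `isTreeWeight_wtT`, `wtT_le_gridLabelWt`, `timeWeight_le_wtT`); the `wt_t`-weighted pinned profile of the grid vertex
  `V_N + 𝒩_{K,N}` is its PLAIN profile — `|U||β|/N` in degree 4 (ultralocal) and `(|β|/N)·Σ_z ‖Ǩ_L(z)‖` in degree 2 (`𝒩_{K,N}` is equal-time: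
  `wtT_pair_sameTime`) — `sum_norm_kernel_gridVertex_mul_wtT_le`;
* §2 **`twoLegGrid_time_row_scaleZero_of_frameOK`** — under p564283's binders (`FrameOK R U Nsc μ K`, `R.WF`, `0 < U`, `|U| ≤ 1`, `klBetaMin ≤ β`,
  the volume thresholds, `a ≥ A(R,U,Nsc)`) and the smallness `e·a·|U|·(4e⁴κ_R + 16e⁸κ₀²) ≤ 1/2`: the TIME row of the atom at `(K, 0)` is
  `≤ 4e²a·(4e⁴κ_R + 16e⁸κ₀²)²·U²·β/(2N)` — pure `U²`, `κ_R = 256((4/3)√(24π²(Gfr₀+1)(Gfr₂+1)) + (128/15)(Gfr₀+1))` `U`-free and depth-free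
  (r2d-p1's original allowance SHAPE; no re-keying of `Zt` under (T)).  The SPACE row in `ĉ`-currency is the sibling file `…FrameBaseChat`.

Raw row inequality only (the atom text is the class-#7 owner's); proofs only; no definitions (the time weight is spelled out); nothing about the
model's sizes is asserted; nothing asserts superconductivity.  `--supports stmt-HubbardSuperconductivity-20437`.
References: BGM 2006 §2.3 (2.17), §3 (3.2)–(3.8) [cite: BenfattoGiulianiMastropietro2006]; Pedra–Salmhofer 2008 Thm 2.4 [cite: PedraSalmhofer2008].
-/

noncomputable section

namespace Summit.HubbardSuperconductivity.HubbardSuperconductivity.Theorems.EngineV8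

set_option linter.dupNamespace false -- summit = problem name (single-conjunct summit), D-0017

open Real Finset Literature.MathematicalPhysics.QuantumLattice Literature.Probability.LatticeModels
open Literature.Probability.LatticeModels.BattleFederbush GrassmannAlgebra
open Summit.HubbardSuperconductivity.HubbardSuperconductivity.Theorems.KLRegimeSplit
open Summit.HubbardSuperconductivity.HubbardSuperconductivity.Theorems.KLProgrammeLegKernels

/-! ## §1 The time-only tree weight on grid legs and the plain-profile vertex bound -/

section TimeWeight

variable {L Ng : ℕ} [NeZero L] [NeZero Ng]

omit [NeZero L] in
/-- The TIME-ONLY label pseudo-distance `d_t((a, x⃗), (b, y⃗)) = (β′/N)·cyclicDist_N(a, b)` on the grid positions (`β′ ≥ 0`). -/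
theorem isLabelDist_gridTimeDist {β' : ℝ} (hβ' : 0 ≤ β') :
    IsLabelDist (fun a b : ZMod Ng × TorusSite 2 L => β' / Ng * cyclicDist Ng a.1 b.1) :=
  ((isLabelDist_cyclicDist Ng).comap (Prod.fst : ZMod Ng × TorusSite 2 L → ZMod Ng)).smul (div_nonneg hβ' (Nat.cast_nonneg _))

omit [NeZero L] [NeZero Ng] in
/-- The time distance is dominated by the full grid distance `gridLabelDist` (the spatial part is nonnegative). -/
theorem gridTimeDist_le_gridLabelDist (β' : ℝ) (a b : ZMod Ng × TorusSite 2 L) :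
    β' / Ng * cyclicDist Ng a.1 b.1 ≤ gridLabelDist L Ng β' a b := by
  rw [gridLabelDist_apply]
  exact le_add_of_nonneg_right (Nat.cast_nonneg _)

omit [NeZero L] [NeZero Ng] in
/-- The time-only diameter weight is dominated by the full one: `1 + diam_{d_t} ≤ gridLabelWt`. -/
theorem wtT_le_gridLabelWt (β' : ℝ) (T : Finset (ZMod Ng × TorusSite 2 L)) :
    diamWeight (fun s => 1 + s) (fun a b : ZMod Ng × TorusSite 2 L => β' / Ng * cyclicDist Ng a.1 b.1) T ≤ gridLabelWt L Ng β' T := by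
  rw [diamWeight, gridLabelWt_apply]
  refine add_le_add le_rfl (labelDiam_le _ (labelDiam_nonneg _ _) fun a ha b hb => ?_)
  exact (gridTimeDist_le_gridLabelDist β' a b).trans (le_labelDiam _ ha hb)

omit [NeZero L] in
/-- **`wt_t(S) = 1 + diam_{d_t}(S.image gridLegPos)` is a tree weight** on grid-leg sets (`β′ ≥ 0`). -/
theorem isTreeWeight_wtT {β' : ℝ} (hβ' : 0 ≤ β') :
    IsTreeWeight (fun S : Finset (GridLeg (GridPoint L Ng)) =>
      diamWeight (fun s => 1 + s) (fun a b : ZMod Ng × TorusSite 2 L => β' / Ng * cyclicDist Ng a.1 b.1) (S.image gridLegPos)) :=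
  (isTreeWeight_diamWeight (isLabelDist_gridTimeDist (L := L) (Ng := Ng) hβ') (fun s hs => by linarith) (fun s t _ hst => by linarith)
    (fun s t hs ht => by nlinarith)).comap gridLegPos

omit [NeZero L] [NeZero Ng] in
/-- `1 ≤ wt_t`. -/
theorem one_le_wtT (β' : ℝ) (T : Finset (ZMod Ng × TorusSite 2 L)) :
    1 ≤ diamWeight (fun s => 1 + s) (fun a b : ZMod Ng × TorusSite 2 L => β' / Ng * cyclicDist Ng a.1 b.1) T := by
  rw [diamWeight]
  exact le_add_of_nonneg_right (labelDiam_nonneg _ _)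

omit [NeZero L] in
/-- **The circular grid time distance is dominated by the time-only pair weight**:
`(β′/N)·circDist_N(j₀, j₁) ≤ wt_t((image Y).image gridLegPos)`. -/
theorem timeWeight_le_wtT (β' : ℝ) (Y : Fin 2 → GridLeg (GridPoint L Ng)) :
    β' / Ng * (circDist Ng (Y 0).1.1.1.val (Y 1).1.1.1.val : ℝ) ≤
      diamWeight (fun s => 1 + s) (fun a b : ZMod Ng × TorusSite 2 L => β' / Ng * cyclicDist Ng a.1 b.1) ((univ.image Y).image gridLegPos) := by
  rw [diamWeight, Finset.image_image, circDist_eq_cyclicDist]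
  have h : β' / Ng * cyclicDist Ng ((gridLegPos (Y 0)).1) ((gridLegPos (Y 1)).1) ≤
      labelDiam (fun a b : ZMod Ng × TorusSite 2 L => β' / Ng * cyclicDist Ng a.1 b.1) (univ.image (gridLegPos ∘ Y)) :=
    le_labelDiam (fun a b : ZMod Ng × TorusSite 2 L => β' / Ng * cyclicDist Ng a.1 b.1)
      (mem_image_of_mem _ (mem_univ 0)) (mem_image_of_mem _ (mem_univ 1))
  rw [gridLegPos_apply, gridLegPos_apply] at h
  have hcast0 : (((Y 0).1.1.1 : ℕ) : ZMod Ng) = ((Y 0).1.1.1.val : ZMod Ng) := rfl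
  have hcast1 : (((Y 1).1.1.1 : ℕ) : ZMod Ng) = ((Y 1).1.1.1.val : ZMod Ng) := rfl
  linarith

/-- **Weighted pinned sums of the quartic grid vertex, time weight**: `Σ_{X : X q = w} ‖kernel V_N 4 X‖·wt_t ≤ |U|·|β|/N` (the vertex is
ultralocal, so `1 ≤ wt_t ≤ gridLabelWt = 1` on its support). -/
theorem sum_norm_kernel_hubbardGridInteraction_mul_wtT_le (β U β' : ℝ) (q : Fin 4) (w : GridLeg (GridPoint L Ng)) :
    ∑ X ∈ univ.filter (fun X : Fin 4 → GridLeg (GridPoint L Ng) => X q = w),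
        ‖kernel ℂ (hubbardGridInteraction L Ng β U) 4 X‖ *
          diamWeight (fun s => 1 + s) (fun a b : ZMod Ng × TorusSite 2 L => β' / Ng * cyclicDist Ng a.1 b.1) ((univ.image X).image gridLegPos) ≤
      |U| * |β| / Ng := by
  refine le_trans (sum_le_sum fun X _ => ?_) (sum_norm_kernel_hubbardGridInteraction_le β U q w)
  by_cases hX : kernel ℂ (hubbardGridInteraction L Ng β U) 4 X = 0
  · rw [hX, norm_zero, zero_mul]
  · have h1 := (wtT_le_gridLabelWt (L := L) (Ng := Ng) β' ((univ.image X).image gridLegPos)).trans_eq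
      (gridLabelWt_image_eq_one_of_kernel_hubbardGridInteraction_ne_zero β β' U X hX)
    have h2 := one_le_wtT (L := L) (Ng := Ng) β' ((univ.image X).image gridLegPos)
    rw [le_antisymm h1 h2, mul_one]

omit [NeZero L] in
/-- The time-only pair weight of the two legs of a time-local hopping monomial `ψ⁺_{(j,x⃗)} ψ⁻_{(j,y⃗)}` is `1`. -/
theorem wtT_pair_sameTime {β' : ℝ} (hβ' : 0 ≤ β') (j : Fin Ng) (x y : TorusSite 2 L) (σ σ' c c' : Fin 2) :
    diamWeight (fun s => 1 + s) (fun a b : ZMod Ng × TorusSite 2 L => β' / Ng * cyclicDist Ng a.1 b.1)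
        {gridLegPos ((((j, x), σ), c) : GridLeg (GridPoint L Ng)), gridLegPos ((((j, y), σ'), c') : GridLeg (GridPoint L Ng))} = 1 := by
  rw [diamWeight_pair (isLabelDist_gridTimeDist (L := L) (Ng := Ng) hβ'), gridLegPos_apply, gridLegPos_apply]
  simp only [(isLabelDist_cyclicDist Ng).self, mul_zero, add_zero]

/-- **Weighted pinned sums of the grid counterterm, time weight = its PLAIN pinned `ℓ¹` size**:
`Σ_{Y : Y p = w} ‖kernel 𝒩_{K,N} 2 Y‖·wt_t ≤ (|β|/N)·Σ_z ‖Ǩ_L(z)‖` (the counterterm is local in time: `wt_t = 1` on every monomial;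
no position moment of `Ǩ_L` is read). -/
theorem sum_norm_kernel_hubbardGridCounterQuadratic_mul_wtT_le (β : ℝ) {β' : ℝ} (hβ' : 0 ≤ β') (K : TrigPolyC4v) (p : Fin 2)
    (w : GridLeg (GridPoint L Ng)) :
    ∑ Y ∈ univ.filter (fun Y : Fin 2 → GridLeg (GridPoint L Ng) => Y p = w),
        ‖kernel ℂ (hubbardGridCounterQuadratic L Ng β K) 2 Y‖ *
          diamWeight (fun s => 1 + s) (fun a b : ZMod Ng × TorusSite 2 L => β' / Ng * cyclicDist Ng a.1 b.1) ((univ.image Y).image gridLegPos) ≤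
      |β| / Ng * ∑ z : TorusSite 2 L, ‖framePosKernel L K z‖ := by
  rw [hubbardGridCounterQuadratic_eq_sum]
  set ω : (Fin 2 → GridLeg (GridPoint L Ng)) → ℝ := fun Y =>
    diamWeight (fun s => 1 + s) (fun a b : ZMod Ng × TorusSite 2 L => β' / Ng * cyclicDist Ng a.1 b.1) ((univ.image Y).image gridLegPos)
    with hω
  have hpairset : ∀ u v : GridLeg (GridPoint L Ng), (univ.image ![u, v]).image gridLegPos = {gridLegPos u, gridLegPos v} := by
    intro u v
    rw [image_image]
    ext z
    simp only [mem_image, mem_univ, true_and, Function.comp_apply, Fin.exists_fin_two, Matrix.cons_val_zero, Matrix.cons_val_one,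
      mem_insert, mem_singleton]
    constructor
    · rintro (h | h)
      exacts [Or.inl h.symm, Or.inr h.symm]
    · rintro (h | h)
      exacts [Or.inl h.symm, Or.inr h.symm]
  have hφa : ∀ i ∈ (univ : Finset (Fin 2 × (GridPoint L Ng × TorusSite 2 L))),
      ω ![(((i.2.1, i.1), 0) : GridLeg (GridPoint L Ng)), ((((i.2.1.1, i.2.2), i.1), 1) : GridLeg (GridPoint L Ng))] ≤ 1 := by
    intro i _
    rw [hω]; dsimp only
    rw [hpairset, show i.2.1 = (i.2.1.1, i.2.1.2) from rfl, wtT_pair_sameTime hβ']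
  have hφb : ∀ i ∈ (univ : Finset (Fin 2 × (GridPoint L Ng × TorusSite 2 L))),
      ω ![((((i.2.1.1, i.2.2), i.1), 1) : GridLeg (GridPoint L Ng)), (((i.2.1, i.1), 0) : GridLeg (GridPoint L Ng))] ≤ 1 := by
    intro i _
    rw [hω]; dsimp only
    rw [hpairset, show i.2.1 = (i.2.1.1, i.2.1.2) from rfl, wtT_pair_sameTime hβ']
  refine sum_norm_kernel_two_structured_mul_wt_le univ _ _ _ ω (fun Y => zero_le_one.trans (one_le_wtT (L := L) (Ng := Ng) β' _))
    (fun _ => 1) hφa hφb (fun w' => ?_) (fun w' => ?_) p w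
  · simpa only [mul_one] using sum_filter_plusLeg_norm_coeff_le_l1 (L := L) (N := Ng) β K w'
  · simpa only [mul_one] using sum_filter_minusLeg_norm_coeff_le_l1 (L := L) (N := Ng) β K w'

omit [NeZero Ng] in
/-- The time-weighted profile of the grid vertex is nonnegative. -/
theorem scaleZeroPinnedT_nonneg (β U : ℝ) (K : TrigPolyC4v) (m' : ℕ) :
    0 ≤ (if m' = 1 then |β| / Ng * ∑ z : TorusSite 2 L, ‖framePosKernel L K z‖ else if m' = 2 then |U| * |β| / Ng else 0 : ℝ) := by
  split_ifs
  · exact mul_nonneg (by positivity) (sum_nonneg fun z _ => norm_nonneg _)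
  · positivity
  · exact le_rfl

/-- **The time-weighted pinned profile of the grid vertex** `V_N + 𝒩_{K,N}` is its PLAIN profile: `N_t(1) = (|β|/N)·Σ_z ‖Ǩ_L(z)‖`,
`N_t(2) = |U||β|/N`, `0` otherwise. -/
theorem sum_norm_kernel_gridVertex_mul_wtT_le (β U : ℝ) {β' : ℝ} (hβ' : 0 ≤ β') (K : TrigPolyC4v) (m' : ℕ) (j : Fin (2 * m'))
    (w : GridLeg (GridPoint L Ng)) :
    ∑ Y ∈ univ.filter (fun Y : Fin (2 * m') → GridLeg (GridPoint L Ng) => Y j = w),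
        ‖kernel ℂ (hubbardGridInteraction L Ng β U + hubbardGridCounterQuadratic L Ng β K) (2 * m') Y‖ *
          diamWeight (fun s => 1 + s) (fun a b : ZMod Ng × TorusSite 2 L => β' / Ng * cyclicDist Ng a.1 b.1) ((univ.image Y).image gridLegPos) ≤
      (if m' = 1 then |β| / Ng * ∑ z : TorusSite 2 L, ‖framePosKernel L K z‖ else if m' = 2 then |U| * |β| / Ng else 0 : ℝ) := by
  rcases m' with _ | _ | _ | m'
  · exact absurd j.2 (by omega)
  · -- degree 2: only the counterterm
    have h : ∀ Y : Fin (2 * 1) → GridLeg (GridPoint L Ng),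
        kernel ℂ (hubbardGridInteraction L Ng β U + hubbardGridCounterQuadratic L Ng β K) (2 * 1) Y =
          kernel ℂ (hubbardGridCounterQuadratic L Ng β K) 2 Y := fun Y => by
      rw [kernel_add, kernel_hubbardGridInteraction_of_ne β U (by norm_num) Y, zero_add]
    simp only [h, if_true]
    exact sum_norm_kernel_hubbardGridCounterQuadratic_mul_wtT_le β hβ' K j w
  · -- degree 4: only the quartic vertex
    have h : ∀ Y : Fin (2 * 2) → GridLeg (GridPoint L Ng),
        kernel ℂ (hubbardGridInteraction L Ng β U + hubbardGridCounterQuadratic L Ng β K) (2 * 2) Y =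
          kernel ℂ (hubbardGridInteraction L Ng β U) 4 Y := fun Y => by
      rw [kernel_add, kernel_hubbardGridCounterQuadratic_of_ne β K (by norm_num) Y, add_zero]
    simp only [h, show (1 + 1 : ℕ) = 2 from rfl, if_true, show (2 : ℕ) ≠ 1 by norm_num, if_false]
    exact sum_norm_kernel_hubbardGridInteraction_mul_wtT_le β U β' j w
  · -- degrees `≥ 6` vanish
    refine le_of_eq_of_le (sum_eq_zero fun Y _ => ?_) (scaleZeroPinnedT_nonneg β U K _)
    rw [kernel_gridVertex_of_two_lt β U K (m' + 3) (by omega) Y, norm_zero, zero_mul]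

end TimeWeight

/-! ## §2 The TIME row of the grid atom at `(K, 0)` in pure `U²` currency -/

section FrameBaseTime

variable {L M : ℕ} [NeZero L] [NeZero M] {R : RenConsts} {μ U β : ℝ} {Nsc : ℕ} {K : TrigPolyC4v}

/-- **THE TIME ROW OF THE GRID ATOM AT `(K, 0)` FOR AN ADMISSIBLE FRAME, IN PURE `U²` CURRENCY** (`FrameOK R U Nsc μ K`, `R.WF`, `0 < U`,
`|U| ≤ 1`, `klBetaMin ≤ β`, the volume thresholds; `a ≥ A(R,U,Nsc)` = p3's `gridLabelWt`-weighted decay constant of the scale-`0` grid covariance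
at frame depth `Nsc`, VERBATIM p564283's `hA`; smallness `e·a·|U|·(4e⁴κ_R + 16e⁸κ₀²) ≤ 1/2`): for both spins and every grid pin `p₀`,
`Σ_{p₁} (β/N)·circDist_N(j₀,j₁)·‖kernel₂ (W_0[K] − 𝒩_{K,N}) ((p₀,σ,+),(p₁,σ,−))‖ ≤ 4e²a·(4e⁴κ_R + 16e⁸κ₀²)²·U²·β/(2N)`,
`κ_R = 256((4/3)√(24π²(Gfr₀+1)(Gfr₂+1)) + (128/15)(Gfr₀+1))`, `κ₀² = 2(7+1606732)` — the time-only tree weight reads the counterterm's PLAIN `ℓ¹`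
size `Σ_z ‖Ǩ_L(z)‖ ≤ κ_R|U|` (`sum_norm_framePosKernel_le_linear_of_frameOK`), never its first position moment. -/
theorem twoLegGrid_time_row_scaleZero_of_frameOK (hK : FrameOK R U Nsc μ K) (hR : R.WF) (hU : 0 < U) (hU1 : |U| ≤ 1) (hβ : klBetaMin ≤ β)
    (hL : klEngL₃ β U ≤ L) (hM : klEngM₃ β U L ≤ M) {a : ℝ} (ha : 0 < a)
    (hA : klScaleZeroA0 + uvTimeMomentConst klE0 7 32 +
          2 * (uvSpaceMomentConst klE0 1 (uvPieceSq klE0 (uvBaseQ klCutoffX5 klE0 4) (uvBaseQ' klCutoffX5 klE0 4)) +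
            (1 / 4 * Real.sqrt (216 * (1 / klE0 + 1 / 2)) *
                ∑ e : Fin 2 × Fin 2, (uvLinV klE0 (1 + (e.1 : ℕ) + (e.2 : ℕ)) *
                    (klCutoffX5 * ((1 + ((e.1 : ℕ) + (e.2 : ℕ)) + 2).factorial : ℝ) * (4 / klE0) ^ (1 + ((e.1 : ℕ) + (e.2 : ℕ)) + 1)) +
                  uvLinD klE0 (1 + (e.1 : ℕ) + (e.2 : ℕ)) *
                    (klCutoffX5 * ((1 + ((e.1 : ℕ) + (e.2 : ℕ)) + 3).factorial : ℝ) * (4 / klE0) ^ (1 + ((e.1 : ℕ) + (e.2 : ℕ)) + 2)))) *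
              (4608 * (1 + R.Gfr 0 + R.Gfr 1 + R.Gfr 2 + R.Gfr 3) ^ 4 * (((Nsc : ℝ) + 1) * U ^ 2 + 2 * |U|))) ≤ a)
    (hsmall : Real.exp 1 * a * |U| *
      (4 * Real.exp 1 ^ 4 * (256 * ((4 / 3) * Real.sqrt (24 * π ^ 2 * (R.Gfr 0 + 1) * (R.Gfr 2 + 1)) + (128 / 15) * (R.Gfr 0 + 1))) +
        16 * Real.exp 1 ^ 8 * Real.sqrt (2 * (7 + 1606732)) ^ 2) ≤ 1 / 2)
    (σ : Fin 2) (p₀ : GridPoint L (2 * (2 * M))) :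
    ∑ p₁ : GridPoint L (2 * (2 * M)),
      β / ((2 * (2 * M) : ℕ) : ℝ) * (circDist (2 * (2 * M)) p₀.1.val p₁.1.val : ℝ) *
        ‖kernel ℂ
          (effAction ℂ ((hubbardGridSub L M β (2 * (2 * M))).transpose *
              hubbardCovAboveCT L M β μ 0 K (klScale klE0 0) * hubbardGridSub L M β (2 * (2 * M)))
            (hubbardGridInteraction L (2 * (2 * M)) β U + hubbardGridCounterQuadratic L (2 * (2 * M)) β K) -
            hubbardGridCounterQuadratic L (2 * (2 * M)) β K) 2
          (fun i => ((![p₀, p₁] i, σ), i))‖ ≤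
      4 * Real.exp 1 ^ 2 * a *
        (4 * Real.exp 1 ^ 4 * (256 * ((4 / 3) * Real.sqrt (24 * π ^ 2 * (R.Gfr 0 + 1) * (R.Gfr 2 + 1)) + (128 / 15) * (R.Gfr 0 + 1))) +
          16 * Real.exp 1 ^ 8 * Real.sqrt (2 * (7 + 1606732)) ^ 2) ^ 2 * U ^ 2 * (β / (2 * ((2 * (2 * M) : ℕ) : ℝ))) := by
  haveI : NeZero (2 * (2 * M)) := ⟨by have := NeZero.ne M; omega⟩
  obtain ⟨hL15, hβL, -, -, -, -⟩ := scaleZero_regime_sizes (U := U) hβ hL hM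
  have hβ0 : 0 < β := lt_of_lt_of_le (by norm_num [klBetaMin]) hβ
  have hN : (0 : ℝ) < ((2 * (2 * M) : ℕ) : ℝ) := by have := NeZero.ne M; positivity
  have hκ : (0 : ℝ) < Real.sqrt (2 * (7 + 1606732)) := Real.sqrt_pos.2 (by norm_num)
  have hsc : klScale klE0 0 = klE0 := by simp [klScale]
  -- the time-only tree weight and its pair sets
  set wt : Finset (GridLeg (GridPoint L (2 * (2 * M)))) → ℝ := fun S =>
    diamWeight (fun s => 1 + s) (fun a b : ZMod (2 * (2 * M)) × TorusSite 2 L => β / ((2 * (2 * M) : ℕ) : ℝ) * cyclicDist (2 * (2 * M)) a.1 b.1)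
      (S.image gridLegPos) with hwt
  have hwtT : IsTreeWeight wt := isTreeWeight_wtT (L := L) (Ng := 2 * (2 * M)) hβ0.le
  have hpair : ∀ X Y : GridLeg (GridPoint L (2 * (2 * M))),
      ({X, Y} : Finset (GridLeg (GridPoint L (2 * (2 * M))))).image gridLegPos = {gridLegPos X, gridLegPos Y} :=
    fun X Y => by rw [image_insert, image_singleton]
  have hwt_le : ∀ X Y : GridLeg (GridPoint L (2 * (2 * M))), wt {X, Y} ≤ gridLabelWt L (2 * (2 * M)) β {gridLegPos X, gridLegPos Y} := by
    intro X Y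
    rw [hwt]; dsimp only
    rw [hpair]
    exact wtT_le_gridLabelWt (L := L) (Ng := 2 * (2 * M)) β _
  -- Gram constant and (time-weighted ≤ fully weighted) decay of the frame-`K` scale-0 grid covariance
  have hGB := isGramBoundedR_scaleZero_of_frameOK (L := L) (M := M) hK hβ hL15 hβL
  have hαpos : 0 < ((2 * (2 * M) : ℕ) : ℝ) / β * a := by positivity
  have hrow : ∀ X, ∑ Y, ‖((hubbardGridSub L M β (2 * (2 * M))).transpose * hubbardCovAboveCT L M β μ 0 K klE0 *
      hubbardGridSub L M β (2 * (2 * M))) X Y‖ * wt {X, Y} ≤ ((2 * (2 * M) : ℕ) : ℝ) / β * a :=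
    fun X => le_trans (sum_le_sum fun Y _ => mul_le_mul_of_nonneg_left (hwt_le X Y) (norm_nonneg _))
      ((rowSum_scaleZero_gridLabelWt_le_X5 (L := L) (M := M) hK hR hU1 hβ hL hM X).trans
        (mul_le_mul_of_nonneg_left hA (div_nonneg hN.le hβ0.le)))
  have hcol : ∀ Y, ∑ X, ‖((hubbardGridSub L M β (2 * (2 * M))).transpose * hubbardCovAboveCT L M β μ 0 K klE0 *
      hubbardGridSub L M β (2 * (2 * M))) X Y‖ * wt {X, Y} ≤ ((2 * (2 * M) : ℕ) : ℝ) / β * a :=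
    fun Y => le_trans (sum_le_sum fun X _ => mul_le_mul_of_nonneg_left (hwt_le X Y) (norm_nonneg _))
      ((colSum_scaleZero_gridLabelWt_le_X5 (L := L) (M := M) hK hR hU1 hβ hL hM Y).trans
        (mul_le_mul_of_nonneg_left hA (div_nonneg hN.le hβ0.le)))
  -- the time-weighted (= PLAIN) pinned profile of the grid vertex with counterterm
  set F₀ : ℝ := ∑ z : TorusSite 2 L, ‖framePosKernel L K z‖ with hF₀
  have hF₀0 : 0 ≤ F₀ := sum_nonneg fun z _ => norm_nonneg _
  have hF : F₀ ≤ 256 * ((4 / 3) * Real.sqrt (24 * π ^ 2 * (R.Gfr 0 + 1) * (R.Gfr 2 + 1)) + (128 / 15) * (R.Gfr 0 + 1)) * |U| :=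
    sum_norm_framePosKernel_le_linear_of_frameOK (L := L) hR hU.ne' hU1 hK
  set Nw : ℕ → ℝ := fun m' => if m' = 1 then |β| / ((2 * (2 * M) : ℕ) : ℝ) * F₀ else if m' = 2 then |U| * |β| / ((2 * (2 * M) : ℕ) : ℝ) else 0
    with hNw
  have hNw0 : ∀ m', 0 ≤ Nw m' := fun m' => by rw [hNw]; dsimp only; split_ifs <;> positivity
  have hNwle : ∀ m' (j : Fin (2 * m')) (w : GridLeg (GridPoint L (2 * (2 * M)))),
      ∑ Y ∈ univ.filter (fun Y : Fin (2 * m') → GridLeg (GridPoint L (2 * (2 * M))) => Y j = w),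
        ‖kernel ℂ (hubbardGridInteraction L (2 * (2 * M)) β U + hubbardGridCounterQuadratic L (2 * (2 * M)) β K) (2 * m') Y‖ *
          wt (univ.image Y) ≤ Nw m' :=
    fun m' j w => by simpa only [hNw, hF₀, hwt] using sum_norm_kernel_gridVertex_mul_wtT_le (L := L) (Ng := 2 * (2 * M)) β U hβ0.le K m' j w
  -- `‖Ṽ‖_h` and `θ_t` in closed form
  set P : ℝ := 4 * Real.exp 1 ^ 4 * F₀ + 16 * Real.exp 1 ^ 8 * Real.sqrt (2 * (7 + 1606732)) ^ 2 * |U| with hP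
  set Q : ℝ := 4 * Real.exp 1 ^ 4 * (256 * ((4 / 3) * Real.sqrt (24 * π ^ 2 * (R.Gfr 0 + 1) * (R.Gfr 2 + 1)) + (128 / 15) * (R.Gfr 0 + 1))) +
    16 * Real.exp 1 ^ 8 * Real.sqrt (2 * (7 + 1606732)) ^ 2 with hQ
  have hP0 : 0 ≤ P := by rw [hP]; positivity
  have hPle : P ≤ |U| * Q := by
    have h4 : 0 ≤ 4 * Real.exp 1 ^ 4 := by positivity
    have h := mul_le_mul_of_nonneg_left hF h4
    have hexp : |U| * Q = 4 * Real.exp 1 ^ 4 *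
        (256 * ((4 / 3) * Real.sqrt (24 * π ^ 2 * (R.Gfr 0 + 1) * (R.Gfr 2 + 1)) + (128 / 15) * (R.Gfr 0 + 1)) * |U|) +
          16 * Real.exp 1 ^ 8 * Real.sqrt (2 * (7 + 1606732)) ^ 2 * |U| := by
      rw [hQ]; ring
    rw [hexp, hP]
    exact add_le_add h le_rfl
  have he2 : Real.exp 2 = Real.exp 1 ^ 2 := by rw [← Real.exp_nat_mul]; norm_num
  have hnV : normV (GridLeg (GridPoint L (2 * (2 * M)))) (Real.sqrt (2 * (7 + 1606732))) (Real.sqrt (2 * (7 + 1606732))) Nw =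
      |β| / ((2 * (2 * M) : ℕ) : ℝ) * Real.sqrt (2 * (7 + 1606732)) ^ 2 * P := by
    rw [hNw, normV_twoStep_eq (four_le_card_gridLeg (L := L) (Ng := 2 * (2 * M))), he2, hP]
    ring
  have hXeq : (Real.sqrt (2 * (7 + 1606732)))⁻¹ ^ 2 *
      (Real.exp 1 * normV (GridLeg (GridPoint L (2 * (2 * M)))) (Real.sqrt (2 * (7 + 1606732))) (Real.sqrt (2 * (7 + 1606732))) Nw) =
        Real.exp 1 * (β / ((2 * (2 * M) : ℕ) : ℝ)) * P := by
    rw [hnV, abs_of_pos hβ0]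
    field_simp
  have hθeq : Real.exp 1 * (((2 * (2 * M) : ℕ) : ℝ) / β * a) *
      normV (GridLeg (GridPoint L (2 * (2 * M)))) (Real.sqrt (2 * (7 + 1606732))) (Real.sqrt (2 * (7 + 1606732))) Nw /
        Real.sqrt (2 * (7 + 1606732)) ^ 2 = Real.exp 1 * a * P := by
    rw [hnV, abs_of_pos hβ0]
    field_simp
  have hθ0 : 0 ≤ Real.exp 1 * a * P := by positivity
  have hθle : Real.exp 1 * a * P ≤ 1 / 2 := by
    refine le_trans ?_ hsmall
    have : Real.exp 1 * a * P ≤ Real.exp 1 * a * (|U| * Q) := mul_le_mul_of_nonneg_left hPle (by positivity)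
    linarith
  have hθlt : Real.exp 1 * (((2 * (2 * M) : ℕ) : ℝ) / β * a) *
      normV (GridLeg (GridPoint L (2 * (2 * M)))) (Real.sqrt (2 * (7 + 1606732))) (Real.sqrt (2 * (7 + 1606732))) Nw /
        Real.sqrt (2 * (7 + 1606732)) ^ 2 < 1 := by
    rw [hθeq]; linarith
  have hX0 : 0 ≤ Real.exp 1 * (β / ((2 * (2 * M) : ℕ) : ℝ)) * P := by positivity
  -- the final estimate: `2·X·θ ≤ 4e²a·Q²·U²·β/(2N)`
  have hfin : 2 * (Real.exp 1 * (β / ((2 * (2 * M) : ℕ) : ℝ)) * P) * (Real.exp 1 * a * P) ≤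
      4 * Real.exp 1 ^ 2 * a * Q ^ 2 * U ^ 2 * (β / (2 * ((2 * (2 * M) : ℕ) : ℝ))) := by
    have hP2 : P ^ 2 ≤ (|U| * Q) ^ 2 := pow_le_pow_left₀ hP0 hPle 2
    have hw : 0 ≤ 2 * Real.exp 1 ^ 2 * a * (β / ((2 * (2 * M) : ℕ) : ℝ)) := by positivity
    calc 2 * (Real.exp 1 * (β / ((2 * (2 * M) : ℕ) : ℝ)) * P) * (Real.exp 1 * a * P)
        = 2 * Real.exp 1 ^ 2 * a * (β / ((2 * (2 * M) : ℕ) : ℝ)) * P ^ 2 := by ring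
      _ ≤ 2 * Real.exp 1 ^ 2 * a * (β / ((2 * (2 * M) : ℕ) : ℝ)) * (|U| * Q) ^ 2 := mul_le_mul_of_nonneg_left hP2 hw
      _ = 4 * Real.exp 1 ^ 2 * a * Q ^ 2 * U ^ 2 * (β / (2 * ((2 * (2 * M) : ℕ) : ℝ))) := by
          rw [mul_pow, sq_abs]; field_simp; ring
  -- the weighted truncated step with the time-only weight and the time pair weight
  set ω : (Fin 2 → GridLeg (GridPoint L (2 * (2 * M)))) → ℝ := fun Y =>
    β / ((2 * (2 * M) : ℕ) : ℝ) * (circDist (2 * (2 * M)) (Y 0).1.1.1.val (Y 1).1.1.1.val : ℝ) with hω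
  have hω0 : ∀ Y, 0 ≤ ω Y := fun Y => by rw [hω]; exact mul_nonneg (div_nonneg hβ0.le (Nat.cast_nonneg _)) (Nat.cast_nonneg _)
  have h := twoLeg_offDiag_wsum_le_of_wgridStep _ β U K hwtT hκ hGB Nw hNw0 hNwle hαpos hrow hcol hκ hθlt ω
    (fun Y hY => timeWeight_eq_zero_of_point_eq _ Y hY) zero_le_one
    (fun Y => by simpa only [hω, hwt, one_mul] using timeWeight_le_wtT (L := L) (Ng := 2 * (2 * M)) β Y)
    (((p₀, σ), 0))
  rw [one_mul] at h
  rw [hsc]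
  refine le_trans ?_ (h.trans ?_)
  · refine le_trans (le_of_eq ?_) (sum_point_string_le_sum_pinned (fun Y => ω Y * ‖kernel ℂ (effAction ℂ _
        (hubbardGridInteraction L (2 * (2 * M)) β U + hubbardGridCounterQuadratic L (2 * (2 * M)) β K) -
          hubbardGridCounterQuadratic L (2 * (2 * M)) β K) 2 Y‖) (fun Y => mul_nonneg (hω0 Y) (norm_nonneg _)) σ p₀)
    refine sum_congr rfl fun p₁ _ => ?_
    simp only [hω, Matrix.cons_val_zero, Matrix.cons_val_one, Matrix.cons_val_fin_one]
  · rw [hXeq, hθeq]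
    exact (mul_div_one_sub_le_of_le_half hX0 hθ0 hθle).trans (hfin.trans (le_of_eq (by rw [hQ])))

end FrameBaseTime

end Summit.HubbardSuperconductivity.HubbardSuperconductivity.Theorems.EngineV8

end
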